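import Mathlib
import HarnessLib
import Summits.PneNP.PneNP.Theorems.CnfIdealGenLengthRankDefectRepresentationsTwoGenerators

/-!
# Sequential insertion: the merge constant depends on the number of cells only (crux `RankDefectRepresentations` =
# stmt-PneNP-18923, line `cell-union-merge`; lead g18)

The lead stub `stub_absoluteMerge` (AMB) asks for an ABSOLUTE merge constant.  This file proves the folklore half-way house
in the kernel (so far only `|X| = 2`, W26 p727869, and `|X| = 4`, `…TwoGenerators` p733525, were theorems):

  `commutingIdempotents_near` — if `P : X → K^{d×d}` and `Q : Y → K^{d×d}` are complete orthogonal systems of idempotents with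
  `rank [P_x, Q_B] ≤ c` for every cell `x` and every union `Q_B`, then there are COMMUTING idempotents `E'_x`, all commuting with
  every `Q_y`, with `rank (P_x − E'_x) ≤ 16 · 4616^{|X|} · c`.

The constant depends on `|X|` ALONE — not on `|Y|`, `d` or the field (any field).  Proof: insert the cells one at a time; the
invariant is an exact system `R` (initially `Q`) refining `Q` and all inserted idempotents, against which every cell still has
union-commutators of rank `≤ v`; W26 (`…AbsoluteMergePair.stub_absoluteMergePair`) inserts the next cell at cost `16 v`, the
refined system is the product with the new two-cell system, and the joint cut lemma (`…JointCutLemma.jointCut`) bounds the new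
cross data by `144·(2·16 v) + 8 v = 4616 v`.  With the decoupling of memo `Lines/cell-union-merge-g18.md` §7 (the `≤ 10r` core
blocks) this gives AMB with `λ = λ(c) = 2^{O(c)}` independent of `|X|` (pencil, memo §8); what stays open is linearity in `c`.
HONEST FRAMING: negative-lane tool; AMB/CoreBE stay open; P ≠ NP is not moved; F-N2 is a FRONTIER formal rung.
-/

set_option linter.dupNamespace false -- `Summit.PneNP.PneNP.…`: summit = sub-problem name (D-0017)

namespace Summit.PneNP.PneNP.Theorems.CnfIdealGenLengthRankDefectRepresentationsSequentialInsertion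

open Matrix
open Summit.PneNP.PneNP.Theorems.CnfIdealGenLengthRankDefectRepresentationsAbsoluteMergePair (stub_absoluteMergePair)
open Summit.PneNP.PneNP.Theorems.CnfIdealGenLengthRankDefectRepresentationsJointCutLemma (jointCut)
open Summit.PneNP.PneNP.Theorems.CnfIdealGenLengthRankDefectRepresentationsTwoGenerators
  (twoCells_idem twoCells_orth twoCells_sum twoCells_comm rank_comm_twoCells_union_le)
open Summit.PneNP.PneNP.Theorems.CnfIdealGenLengthRankDefectRepresentationsPolyOfAbsoluteMergeLevels
  (prod_cells_idem prod_cells_orth prod_cells_sum rank_comm_symm)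
open Summit.PneNP.PneNP.Theorems.CnfIdealGenLengthRankDefectRepresentationsInsertion (comm_sum_of_comm_cells)

variable {K : Type} [Field K] {d : ℕ}

/-- The insertion invariant after a set `T` of cells has been processed: an exact system `R` on some finite index type
refining every `Q_y` and every inserted idempotent `E'_x` (`x ∈ T`), the inserted idempotents within rank `s` of their cells,
and every cell of `P` with union-commutators of rank `≤ v` against `R`. -/
theorem invariant_step {X Y : Type} [Fintype Y] [DecidableEq X] [DecidableEq Y]
    (P : X → Matrix (Fin d) (Fin d) K) (Q : Y → Matrix (Fin d) (Fin d) K)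
    (hPi : ∀ x, P x * P x = P x) (hPo : ∀ x x', x ≠ x' → P x * P x' = 0)
    (T : Finset X) (x₀ : X) (v s : ℕ)
    (hinv : ∃ (ι : Type) (_ : Fintype ι) (_ : DecidableEq ι) (R : ι → Matrix (Fin d) (Fin d) K)
        (E' : X → Matrix (Fin d) (Fin d) K),
      (∀ i, R i * R i = R i) ∧ (∀ i j, i ≠ j → R i * R j = 0) ∧ ∑ i, R i = 1 ∧
      (∀ y, ∃ S : Finset ι, Q y = ∑ i ∈ S, R i) ∧
      (∀ x ∈ T, E' x * E' x = E' x ∧ (∃ S : Finset ι, E' x = ∑ i ∈ S, R i) ∧ (P x - E' x).rank ≤ s) ∧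
      (∀ x (C : Finset ι), (P x * (∑ i ∈ C, R i) - (∑ i ∈ C, R i) * P x).rank ≤ v)) :
    ∃ (ι : Type) (_ : Fintype ι) (_ : DecidableEq ι) (R : ι → Matrix (Fin d) (Fin d) K)
        (E' : X → Matrix (Fin d) (Fin d) K),
      (∀ i, R i * R i = R i) ∧ (∀ i j, i ≠ j → R i * R j = 0) ∧ ∑ i, R i = 1 ∧
      (∀ y, ∃ S : Finset ι, Q y = ∑ i ∈ S, R i) ∧
      (∀ x ∈ insert x₀ T, E' x * E' x = E' x ∧ (∃ S : Finset ι, E' x = ∑ i ∈ S, R i) ∧ (P x - E' x).rank ≤ s + 16 * v) ∧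
      (∀ x (C : Finset ι), (P x * (∑ i ∈ C, R i) - (∑ i ∈ C, R i) * P x).rank ≤ 4616 * v) := by
  classical
  obtain ⟨ι, _, _, R, E', hRi, hRo, hRs, hQR, hT, hv⟩ := hinv
  -- insert the cell `x₀` against `R` (W26)
  obtain ⟨E, hEi, hER, hEr⟩ := stub_absoluteMergePair K d ι (P x₀) R v (hPi x₀) hRi hRo hRs (hv x₀)
  -- the refined system: two-cell system of `E` times `R`
  let C2 : Bool → Matrix (Fin d) (Fin d) K := fun b => bif b then E else 1 - E
  have hC2i : ∀ b, C2 b * C2 b = C2 b := twoCells_idem E hEi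
  have hC2o : ∀ b b', b ≠ b' → C2 b * C2 b' = 0 := twoCells_orth E hEi
  have hC2s : ∑ b, C2 b = 1 := twoCells_sum E
  have hC2R : ∀ b i, C2 b * R i = R i * C2 b := fun b i => twoCells_comm E (R i) (hER i) b
  let R' : Bool × ι → Matrix (Fin d) (Fin d) K := fun p => C2 p.1 * R p.2
  have hR'i : ∀ p, R' p * R' p = R' p := fun p => prod_cells_idem C2 R hC2i hRi hC2R p
  have hR'o : ∀ p q, p ≠ q → R' p * R' q = 0 := fun p q h => prod_cells_orth C2 R hC2o hRo hC2R p q h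
  have hR's : ∑ p, R' p = 1 := prod_cells_sum C2 R hC2s hRs
  -- unions of `R` are unions (cylinders) of `R'`
  have hcyl : ∀ S : Finset ι, ∑ i ∈ S, R i = ∑ p ∈ (Finset.univ : Finset Bool) ×ˢ S, R' p := by
    intro S
    rw [Finset.sum_product, Finset.sum_comm]
    refine Finset.sum_congr rfl fun i _ => ?_
    show R i = ∑ b, C2 b * R i
    rw [← Finset.sum_mul, hC2s, Matrix.one_mul]
  have hEcyl : E = ∑ p ∈ ({true} : Finset Bool) ×ˢ (Finset.univ : Finset ι), R' p := by
    rw [Finset.sum_product, Finset.sum_singleton]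
    show E = ∑ i, C2 true * R i
    rw [← Finset.mul_sum, hRs, Matrix.mul_one]
    rfl
  refine ⟨Bool × ι, inferInstance, inferInstance, R', Function.update E' x₀ E, hR'i, hR'o, hR's, ?_, ?_, ?_⟩
  · intro y
    obtain ⟨S, hS⟩ := hQR y
    exact ⟨Finset.univ ×ˢ S, by rw [hS, hcyl]⟩
  · intro x hx
    by_cases hxx : x = x₀
    · subst hxx
      rw [Function.update_self]
      exact ⟨hEi, ⟨_, hEcyl⟩, hEr.trans (by omega)⟩
    · rw [Function.update_of_ne hxx]
      have hxT : x ∈ T := (Finset.mem_insert.mp hx).resolve_left hxx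
      obtain ⟨h1, ⟨S, hS⟩, h3⟩ := hT x hxT
      exact ⟨h1, ⟨Finset.univ ×ˢ S, by rw [hS, hcyl]⟩, h3.trans (by omega)⟩
  · -- the new cross data, by the joint cut lemma for the commuting pair `(C2, R)` and the observer `P x`
    intro x C
    have hPE : ∀ A : Finset Bool, ((∑ b ∈ A, C2 b) * P x - P x * ∑ b ∈ A, C2 b).rank ≤ 32 * v := by
      intro A
      rw [rank_comm_symm]
      have hcomm : P x * P x₀ = P x₀ * P x := by
        by_cases h : x = x₀
        · subst h; rfl
        · rw [hPo x x₀ h, hPo x₀ x (Ne.symm h)]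
      refine (rank_comm_twoCells_union_le (P x₀) E (P x) hcomm A).trans ?_
      omega
    have hPR : ∀ B : Finset ι, ((∑ i ∈ B, R i) * P x - P x * ∑ i ∈ B, R i).rank ≤ v := by
      intro B; rw [rank_comm_symm]; exact hv x B
    have key := jointCut C2 R (P x) (32 * v) v hC2i hC2o hC2s hRi hRo hRs hC2R hPE hPR C
    rw [rank_comm_symm]
    refine key.trans ?_
    omega

/-- **Commuting idempotents near the cells, at a cost depending on `|X|` only.**  For complete orthogonal systems `P, Q` with
`rank [P_x, Q_B] ≤ c` for every cell `x` and union `B`: commuting idempotents `E'_x`, each a union of cells of one exact system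
refining `Q` (so commuting with every `Q_y` and with each other), with `rank (P_x − E'_x) ≤ 16 · 4616^{|X|} · c`.  (Any field.) -/
theorem commutingIdempotents_near {X Y : Type} [Fintype X] [Fintype Y] [DecidableEq X] [DecidableEq Y]
    (P : X → Matrix (Fin d) (Fin d) K) (Q : Y → Matrix (Fin d) (Fin d) K) (c : ℕ)
    (hPi : ∀ x, P x * P x = P x) (hPo : ∀ x x', x ≠ x' → P x * P x' = 0)
    (hQi : ∀ y, Q y * Q y = Q y) (hQo : ∀ y y', y ≠ y' → Q y * Q y' = 0) (hQs : ∑ y, Q y = 1)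
    (hc : ∀ x (B : Finset Y), (P x * (∑ y ∈ B, Q y) - (∑ y ∈ B, Q y) * P x).rank ≤ c) :
    ∃ (ι : Type) (_ : Fintype ι) (_ : DecidableEq ι) (R : ι → Matrix (Fin d) (Fin d) K)
        (E' : X → Matrix (Fin d) (Fin d) K),
      (∀ i, R i * R i = R i) ∧ (∀ i j, i ≠ j → R i * R j = 0) ∧ ∑ i, R i = 1 ∧
      (∀ y, ∃ S : Finset ι, Q y = ∑ i ∈ S, R i) ∧
      (∀ x, E' x * E' x = E' x ∧ (∃ S : Finset ι, E' x = ∑ i ∈ S, R i) ∧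
        (P x - E' x).rank ≤ 16 * 4616 ^ (Fintype.card X) * c) := by
  classical
  -- induction over the cells, with the invariant at levels `v_T = 4616^{|T|} c`, `s_T = 16 · 4616^{|T|} c`
  have main : ∀ T : Finset X, ∃ (ι : Type) (_ : Fintype ι) (_ : DecidableEq ι) (R : ι → Matrix (Fin d) (Fin d) K)
        (E' : X → Matrix (Fin d) (Fin d) K),
      (∀ i, R i * R i = R i) ∧ (∀ i j, i ≠ j → R i * R j = 0) ∧ ∑ i, R i = 1 ∧
      (∀ y, ∃ S : Finset ι, Q y = ∑ i ∈ S, R i) ∧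
      (∀ x ∈ T, E' x * E' x = E' x ∧ (∃ S : Finset ι, E' x = ∑ i ∈ S, R i) ∧
        (P x - E' x).rank ≤ 16 * 4616 ^ T.card * c) ∧
      (∀ x (C : Finset ι), (P x * (∑ i ∈ C, R i) - (∑ i ∈ C, R i) * P x).rank ≤ 4616 ^ T.card * c) := by
    intro T
    induction T using Finset.induction_on with
    | empty =>
      refine ⟨Y, inferInstance, inferInstance, Q, fun _ => 0, hQi, hQo, hQs, fun y => ⟨{y}, ?_⟩, fun x hx => ?_, ?_⟩
      · rw [Finset.sum_singleton]
      · exact absurd hx (Finset.notMem_empty x)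
      · intro x C
        rw [Finset.card_empty, pow_zero, one_mul]
        exact hc x C
    | insert x₀ T hx₀ ih =>
      obtain ⟨ι, hι, hd, R, E', h1, h2, h3, h4, h5, h6⟩ :=
        invariant_step P Q hPi hPo T x₀ (4616 ^ T.card * c) (16 * 4616 ^ T.card * c) ih
      refine ⟨ι, hι, hd, R, E', h1, h2, h3, h4, fun x hx => ?_, fun x C => ?_⟩
      · obtain ⟨a, b, hr⟩ := h5 x hx
        refine ⟨a, b, hr.trans ?_⟩
        rw [Finset.card_insert_of_notMem hx₀, pow_succ]
        nlinarith [Nat.one_le_pow T.card 4616 (by norm_num)]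
      · refine (h6 x C).trans ?_
        rw [Finset.card_insert_of_notMem hx₀, pow_succ]
        linarith
  obtain ⟨ι, hι, hd, R, E', h1, h2, h3, h4, h5, -⟩ := main Finset.univ
  exact ⟨ι, hι, hd, R, E', h1, h2, h3, h4, fun x => by
    have := h5 x (Finset.mem_univ x); rwa [Finset.card_univ] at this⟩


/-! ## Assembly: an exact system `P'` commuting with `Q`, at a cost depending on `|X|` only -/

/-- Rank of a union of cells is monotone along a covering by two unions. [folklore] -/
theorem rank_cells_union_le {ι : Type} [DecidableEq ι] (R : ι → Matrix (Fin d) (Fin d) K)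
    (hRi : ∀ i, R i * R i = R i) (hRo : ∀ i j, i ≠ j → R i * R j = 0) (A B : Finset ι) (h : A ⊆ B) :
    (∑ i ∈ A, R i).rank ≤ (∑ i ∈ B, R i).rank := by
  have : ∑ i ∈ A, R i = (∑ i ∈ B, R i) * ∑ i ∈ A, R i := by
    rw [Summit.PneNP.PneNP.Theorems.CnfIdealGenLengthRankDefectRepresentationsPolyOfAbsoluteMergeLevels.cells_sum_mul_sum
      R hRi hRo, Finset.inter_eq_right.mpr h]
  rw [this]
  exact Matrix.rank_mul_le_left _ _

/-- Rank of a union of cells over a union of index sets is at most the sum of the ranks. [folklore] -/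
theorem rank_cells_biUnion_le {ι J : Type} [DecidableEq ι] [DecidableEq J] (R : ι → Matrix (Fin d) (Fin d) K)
    (hRi : ∀ i, R i * R i = R i) (hRo : ∀ i j, i ≠ j → R i * R j = 0) (T : Finset J) (A : J → Finset ι) :
    (∑ i ∈ T.biUnion A, R i).rank ≤ ∑ j ∈ T, (∑ i ∈ A j, R i).rank := by
  induction T using Finset.induction_on with
  | empty => simp
  | insert j T hj ih =>
    rw [Finset.biUnion_insert, Finset.sum_insert hj]
    have e : ∑ i ∈ A j ∪ T.biUnion A, R i = (∑ i ∈ A j, R i) + ∑ i ∈ T.biUnion A \ A j, R i := by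
      rw [← Finset.sum_union Finset.disjoint_sdiff, Finset.union_sdiff_self_eq_union]
    rw [e]
    refine (Summit.PneNP.PneNP.Theorems.CnfIdealGenLengthRankDefectRepresentationsMergeLowerBound.rank_add_le' _ _).trans
      (Nat.add_le_add_left ((rank_cells_union_le R hRi hRo _ _ Finset.sdiff_subset).trans ih) _)

/-- **AMB-shape with a constant depending on `|X|` only, `Q' = Q`.**  For complete orthogonal systems `P, Q` with
`rank [P_x, Q_B] ≤ c` for every cell `x` and union `B`, there is a complete orthogonal system `P'` commuting with every `Q_y`
with `rank (P_A − P'_A) ≤ 32 · |X|³ · 4616^{|X|} · c` for every union `A`.  (Any field.) -/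
theorem absoluteMerge_card {X Y : Type} [Fintype X] [Fintype Y] [DecidableEq X] [DecidableEq Y]
    (P : X → Matrix (Fin d) (Fin d) K) (Q : Y → Matrix (Fin d) (Fin d) K) (c : ℕ)
    (hPi : ∀ x, P x * P x = P x) (hPo : ∀ x x', x ≠ x' → P x * P x' = 0) (hPs : ∑ x, P x = 1)
    (hQi : ∀ y, Q y * Q y = Q y) (hQo : ∀ y y', y ≠ y' → Q y * Q y' = 0) (hQs : ∑ y, Q y = 1)
    (hc : ∀ x (B : Finset Y), (P x * (∑ y ∈ B, Q y) - (∑ y ∈ B, Q y) * P x).rank ≤ c) :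
    ∃ P' : X → Matrix (Fin d) (Fin d) K,
      (∀ x, P' x * P' x = P' x) ∧ (∀ x x', x ≠ x' → P' x * P' x' = 0) ∧ ∑ x, P' x = 1 ∧
      (∀ x y, P' x * Q y = Q y * P' x) ∧
      ∀ A : Finset X, ((∑ x ∈ A, P x) - ∑ x ∈ A, P' x).rank ≤
        32 * Fintype.card X ^ 3 * 4616 ^ (Fintype.card X) * c := by
  classical
  set m := Fintype.card X with hm
  set s := 16 * 4616 ^ m * c with hs
  obtain ⟨ι, hι, hdι, R, E', hRi, hRo, hRs, hQR, hE'⟩ := commutingIdempotents_near P Q c hPi hPo hQi hQo hQs hc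
  choose S hS using fun x => (hE' x).2.1
  have hcost : ∀ x, (P x - E' x).rank ≤ s := fun x => (hE' x).2.2
  -- `X` is nonempty unless `d = 0`-like degenerate; pick a default cell when possible
  by_cases hX : Nonempty X
  swap
  · refine ⟨P, hPi, hPo, hPs, fun x => absurd ⟨x⟩ hX, fun A => ?_⟩
    rw [sub_self, Matrix.rank_zero]; exact Nat.zero_le _
  obtain ⟨x₀⟩ := hX
  -- the private part of `S x` and the assignment of cells of `R` to cells of `P'`
  let D : X → Finset ι := fun x =>
    if x = x₀ then Finset.univ \ (Finset.univ.erase x₀).biUnion fun x' => (S x').filter fun i => ∀ x'' ≠ x', i ∉ S x''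
    else (S x).filter fun i => ∀ x'' ≠ x, i ∉ S x''
  have hDne : ∀ x, x ≠ x₀ → D x = (S x).filter fun i => ∀ x'' ≠ x, i ∉ S x'' := fun x hx => if_neg hx
  have hD0 : D x₀ = Finset.univ \ (Finset.univ.erase x₀).biUnion fun x' => (S x').filter fun i => ∀ x'' ≠ x', i ∉ S x'' :=
    if_pos rfl
  have hdisj : ∀ x x', x ≠ x' → Disjoint (D x) (D x') := by
    intro x x' hxx'
    rw [Finset.disjoint_left]
    intro i hi hi'
    by_cases hx : x = x₀
    · subst hx
      rw [hD0, Finset.mem_sdiff] at hi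
      apply hi.2
      rw [Finset.mem_biUnion]
      refine ⟨x', Finset.mem_erase.mpr ⟨Ne.symm hxx', Finset.mem_univ _⟩, ?_⟩
      rwa [hDne x' (Ne.symm hxx')] at hi'
    · by_cases hx' : x' = x₀
      · subst hx'
        rw [hD0, Finset.mem_sdiff] at hi'
        apply hi'.2
        rw [Finset.mem_biUnion]
        refine ⟨x, Finset.mem_erase.mpr ⟨hxx', Finset.mem_univ _⟩, ?_⟩
        rwa [hDne x hxx'] at hi
      · rw [hDne x hx, Finset.mem_filter] at hi
        rw [hDne x' hx', Finset.mem_filter] at hi'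
        exact hi.2 x' (Ne.symm hxx') hi'.1
  have hcover : ∀ i, ∃ x, i ∈ D x := by
    intro i
    by_cases h : ∃ x, x ≠ x₀ ∧ i ∈ D x
    · obtain ⟨x, -, hx⟩ := h; exact ⟨x, hx⟩
    · refine ⟨x₀, ?_⟩
      rw [hD0, Finset.mem_sdiff, Finset.mem_biUnion]
      refine ⟨Finset.mem_univ i, ?_⟩
      rintro ⟨x', hx', hi⟩
      have hne : x' ≠ x₀ := (Finset.mem_erase.mp hx').1
      exact h ⟨x', hne, by rwa [hDne x' hne]⟩
  let P' : X → Matrix (Fin d) (Fin d) K := fun x => ∑ i ∈ D x, R i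
  have hmul := Summit.PneNP.PneNP.Theorems.CnfIdealGenLengthRankDefectRepresentationsPolyOfAbsoluteMergeLevels.cells_sum_mul_sum
    R hRi hRo
  have hP'i : ∀ x, P' x * P' x = P' x := fun x => by
    show (∑ i ∈ D x, R i) * (∑ i ∈ D x, R i) = ∑ i ∈ D x, R i
    rw [hmul, Finset.inter_self]
  have hP'o : ∀ x x', x ≠ x' → P' x * P' x' = 0 := fun x x' h => by
    show (∑ i ∈ D x, R i) * (∑ i ∈ D x', R i) = 0
    rw [hmul, Finset.disjoint_iff_inter_eq_empty.mp (hdisj x x' h), Finset.sum_empty]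
  have hP's : ∑ x, P' x = 1 := by
    show ∑ x, ∑ i ∈ D x, R i = 1
    rw [← Finset.sum_biUnion (fun x _ x' _ h => hdisj x x' h)]
    have : (Finset.univ.biUnion D) = Finset.univ := by
      ext i
      simp only [Finset.mem_biUnion, Finset.mem_univ, true_and, iff_true]
      exact hcover i
    rw [this, hRs]
  have hP'Q : ∀ x y, P' x * Q y = Q y * P' x := by
    intro x y
    obtain ⟨T, hT⟩ := hQR y
    show (∑ i ∈ D x, R i) * Q y = Q y * ∑ i ∈ D x, R i
    rw [hT, hmul, hmul, Finset.inter_comm]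
  -- costs: for `x ≠ x₀`, `E'_x − P'_x` is the union of the cells of `S x` shared with other `S x'`
  have hEE : ∀ x x', x ≠ x' → ((∑ i ∈ S x ∩ S x', R i)).rank ≤ 2 * s := by
    intro x x' hxx'
    rw [← hmul, ← hS, ← hS]
    have e : E' x * E' x' = (E' x - P x) * E' x' + P x * (E' x' - P x') := by
      rw [Matrix.sub_mul, Matrix.mul_sub, hPo x x' hxx']; abel
    rw [e]
    refine (Summit.PneNP.PneNP.Theorems.CnfIdealGenLengthRankDefectRepresentationsMergeLowerBound.rank_add_le' _ _).trans ?_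
    have h1 : ((E' x - P x) * E' x').rank ≤ s :=
      (Matrix.rank_mul_le_left _ _).trans (by rw [← neg_sub, Summit.PneNP.PneNP.Theorems.CnfIdealGenLengthRankDefectRepresentationsMergeLowerBound.rank_neg']; exact hcost x)
    have h2 : (P x * (E' x' - P x')).rank ≤ s :=
      (Matrix.rank_mul_le_right _ _).trans (by rw [← neg_sub, Summit.PneNP.PneNP.Theorems.CnfIdealGenLengthRankDefectRepresentationsMergeLowerBound.rank_neg']; exact hcost x')
    omega
  have hEP' : ∀ x, x ≠ x₀ → (E' x - P' x).rank ≤ (Finset.univ.erase x).card * (2 * s) := by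
    intro x hx
    have hsub : D x ⊆ S x := by rw [hDne x hx]; exact Finset.filter_subset _ _
    have e : E' x - P' x = ∑ i ∈ S x \ D x, R i := by
      show E' x - ∑ i ∈ D x, R i = _
      rw [hS x, ← Finset.sum_sdiff hsub, add_sub_cancel_right]
    rw [e]
    have hcov : S x \ D x ⊆ (Finset.univ.erase x).biUnion fun x' => S x ∩ S x' := by
      intro i hi
      rw [Finset.mem_sdiff, hDne x hx, Finset.mem_filter] at hi
      obtain ⟨hiS, hnot⟩ := hi
      rw [Finset.mem_biUnion]
      by_contra hcon
      apply hnot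
      refine ⟨hiS, fun x'' hx'' hi'' => hcon ⟨x'', Finset.mem_erase.mpr ⟨hx'', Finset.mem_univ _⟩, ?_⟩⟩
      exact Finset.mem_inter.mpr ⟨hiS, hi''⟩
    refine (rank_cells_union_le R hRi hRo _ _ hcov).trans ((rank_cells_biUnion_le R hRi hRo _ _).trans ?_)
    have h := Finset.sum_le_sum fun x' (hx' : x' ∈ Finset.univ.erase x) => hEE x x' (Ne.symm (Finset.mem_erase.mp hx').1)
    rwa [Finset.sum_const, smul_eq_mul] at h
  -- per-cell costs
  have hmpos : 0 < m := by rw [hm]; exact Fintype.card_pos_iff.mpr ⟨x₀⟩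
  have hm1 : ∀ x : X, (Finset.univ.erase x).card + 1 = m := fun x => by
    rw [Finset.card_erase_of_mem (Finset.mem_univ x), Finset.card_univ]
    exact Nat.sub_add_cancel hmpos
  have hcell : ∀ x, x ≠ x₀ → (P x - P' x).rank ≤ 2 * m * s := by
    intro x hx
    calc (P x - P' x).rank ≤ (P x - E' x).rank + (E' x - P' x).rank :=
          Summit.PneNP.PneNP.Theorems.CnfIdealGenLengthRankDefectRepresentationsPolyOfAbsoluteMergeLevels.rank_sub_triangle _ _ _
      _ ≤ s + (Finset.univ.erase x).card * (2 * s) := Nat.add_le_add (hcost x) (hEP' x hx)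
      _ ≤ 2 * m * s := by nlinarith [hm1 x]
  have hcell₀ : (P x₀ - P' x₀).rank ≤ 2 * m * m * s := by
    have e : P x₀ - P' x₀ = -∑ x ∈ Finset.univ.erase x₀, (P x - P' x) := by
      have h1 : P x₀ = 1 - ∑ x ∈ Finset.univ.erase x₀, P x := by
        rw [← hPs, ← Finset.add_sum_erase _ _ (Finset.mem_univ x₀)]; abel
      have h2 : P' x₀ = 1 - ∑ x ∈ Finset.univ.erase x₀, P' x := by
        rw [← hP's, ← Finset.add_sum_erase _ _ (Finset.mem_univ x₀)]; abel
      rw [h1, h2, Finset.sum_sub_distrib]; abel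
    rw [e, Summit.PneNP.PneNP.Theorems.CnfIdealGenLengthRankDefectRepresentationsMergeLowerBound.rank_neg']
    refine (Summit.PneNP.PneNP.Theorems.CnfIdealGenLengthRankDefectRepresentationsCutLemmaMaxCut.rank_finsetSum_le _ _).trans
      ?_
    calc ∑ x ∈ Finset.univ.erase x₀, (P x - P' x).rank ≤ ∑ x ∈ Finset.univ.erase x₀, 2 * m * s :=
          Finset.sum_le_sum fun x hx => hcell x (Finset.mem_erase.mp hx).1
      _ = (Finset.univ.erase x₀).card * (2 * m * s) := by rw [Finset.sum_const, smul_eq_mul]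
      _ ≤ m * (2 * m * s) := Nat.mul_le_mul_right _ (by have := hm1 x₀; omega)
      _ = 2 * m * m * s := by ring
  refine ⟨P', hP'i, hP'o, hP's, hP'Q, fun A => ?_⟩
  rw [← Finset.sum_sub_distrib]
  refine (Summit.PneNP.PneNP.Theorems.CnfIdealGenLengthRankDefectRepresentationsCutLemmaMaxCut.rank_finsetSum_le A _).trans ?_
  calc ∑ x ∈ A, (P x - P' x).rank ≤ ∑ x ∈ A, 2 * m * m * s := by
        refine Finset.sum_le_sum fun x _ => ?_
        by_cases hx : x = x₀
        · subst hx; exact hcell₀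
        · exact (hcell x hx).trans (by nlinarith [hmpos])
    _ = A.card * (2 * m * m * s) := by rw [Finset.sum_const, smul_eq_mul]
    _ ≤ m * (2 * m * m * s) := Nat.mul_le_mul_right _ (by rw [hm]; exact Finset.card_le_univ A)
    _ = 32 * m ^ 3 * 4616 ^ m * c := by rw [hs]; ring

end Summit.PneNP.PneNP.Theorems.CnfIdealGenLengthRankDefectRepresentationsSequentialInsertion
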